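import Mathlib
import Summits.MatrixMultiplication.Statement
import Summits.MatrixMultiplication.MatrixMultiplication.Theorems.GraphEquationsInitialForms
import Summits.MatrixMultiplication.MatrixMultiplication.Theorems.GraphEquationsPureForms
import Summits.MatrixMultiplication.MatrixMultiplication.Theorems.GraphEquationsPurification
import Summits.MatrixMultiplication.MatrixMultiplication.Theses.GraphEquations

/-!
# Lines/initform.lean (v2, hygiene re-registration after M11/M12) — line «initial-form rank» — crux `MultiplicityReduction` (item stmt-MatrixMultiplication-27806) (`H_mult`, ATTACKED) of route `GraphEquations`

LINE «initial-form rank» (higher-order truncation).  The reduced branch truncates a cheap equation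
system at a reduced point of `W_n` to SECOND order; the kernels `GraphEquationsWeightedTruncation`
(M7), `GraphEquationsInitialForms` (M8) and `GraphEquationsPureForms` (M9a) carry Strassen's
truncation to ARBITRARY bounded weighted order `K` (`w(a)=w(b)=1`, `w(c)=2`): if the order-`≤ K`
weighted initial forms of the shifted tests at some point of the graph are PURE — polynomials
`P_o(f)` in the generators `f_q = c_q − Σ_k a_{q₁k} b_{kq₂}` — and ISOLATED — the fibre of
`P = (P_o)` through `0` is `{0}` — then `R(⟨n,n,n⟩) ≤ 2K²·cost`, hence `ω ≤ β` and, at a midpoint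
exponent, reduced systems.

v2 (2026-08-31, after lens-5 g26): the v1 skeleton (tree sha16 e658b9c7275601bb) had TWO stubs,
`stub_purification` and `stub_isolatedForcesRank` (GENERAL polynomial families: isolated fibre ⇒
generic Jacobian rank `n²`).  Kernel M11 `GraphEquationsIsolatedRank` proved the rank statement FOR
FORMS (`isolatedForcesRank_of_isHomogeneous`: graded Noether normalisation + Jacobian criterion),
and kernel M12 `GraphEquationsPurification` proved that pure initial forms ARE forms, so that
`Purification.multiplicityReduction : Purification → MultiplicityReduction` holds with NO rank
hypothesis and `multiplicityReduction_iff_purification : H_mult ↔ Purification`.  Hence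
`stub_isolatedForcesRank` is no longer load-bearing and is DROPPED here (its general form stays true
on paper — Chevalley semicontinuity — and unneeded); the composition below closes the crux from
`stub_purification` ALONE through M12.  HONEST STATUS: this line now has ONE load-bearing stub,
which is the crux RE-TYPED as `Purification` (EQUIV by name, M12) — a reformulation, «0/1 split»;
depth must come from a GENUINE split of `Purification` (NODE-g26 §3c: `InitIsolatedAt` +
`P_alg` per-system initial-ideal isolation ∧ `P_cost` bounded-order cheap standard-basis elements
along the family), to be staged with TWO witnesses of weakness (critic l.1431 s1) and adopted as the
successor skeleton; this v2 registration is registry HYGIENE only (it expires the moot sorried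
`stub_isolatedForcesRank` so that no stub seat is drawn to it).  Sorries exactly in the one stub.
-/

set_option linter.dupNamespace false

namespace Summit.MatrixMultiplication.MatrixMultiplication.Cruxes.MultiplicityReduction.Initform

open Summit.MatrixMultiplication.MatrixMultiplication.Theorems.GraphEquations
  (EqSystem GraphVars mmGraph EqAdmissible EqAdmissibleRed EqAdmissiblePure Purification)
open Summit.MatrixMultiplication.MatrixMultiplication.Theses.GraphEquations (MultiplicityReduction)

/-- STUB 1 (open core, the ONLY load-bearing stub after M12): PURIFICATION — admissible verification
exponents are attained, up to `ε`, by correct families with PURE ISOLATED initial forms of bounded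
order at some point of the graph (`EqAdmissiblePure`, M9a).  Equivalent BY NAME to the crux
(`multiplicityReduction_iff_purification`, M12); the genuine split `P_alg ∧ P_cost` is OWED. -/
theorem stub_purification : ∀ β : ℝ, 2 ≤ β → EqAdmissible β → ∀ β' : ℝ, β < β' →
    ∃ (K : ℕ) (c : ℝ), ∀ n : ℕ, 1 ≤ n → ∃ E : EqSystem n, E.Correct ∧ E.PureIsolated K ∧
      (E.cost : ℝ) ≤ c * (n : ℝ) ^ β' := by
  sorry

/-- COMPOSITION (kernel-checked, no sorry of its own): the stub gives the crux BY NAME through the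
landed kernel `Purification.multiplicityReduction` (M12) ← `isolatedForcesRank_of_isHomogeneous`
(M11) + `multiplicityReduction_of_purification` (M9a) ← `tensorRank_le_of_initNondegAt` (M8) ←
`exists_weightedTruncation` (M7). -/
theorem MultiplicityReduction_of :
    Summit.MatrixMultiplication.MatrixMultiplication.Theses.GraphEquations.MultiplicityReduction :=
  Purification.multiplicityReduction stub_purification

end Summit.MatrixMultiplication.MatrixMultiplication.Cruxes.MultiplicityReduction.Initform

#print axioms Summit.MatrixMultiplication.MatrixMultiplication.Cruxes.MultiplicityReduction.Initform.MultiplicityReduction_of
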